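import Summits.BirchSwinnertonDyer.BirchSwinnertonDyer.Theorems.EisensteinPrimesResidualIndexHZero
import Literature.NumberTheory.EllipticCurves.SelmerCorankAssembly
import Literature.NumberTheory.EllipticCurves.PointDivisibilityProofs
import Summits.BirchSwinnertonDyer.BirchSwinnertonDyer.Theorems.EisensteinPrimesIndexInputsReps
import Summits.BirchSwinnertonDyer.BirchSwinnertonDyer.Theorems.EisensteinPrimesIndexInputsCot
import Summits.BirchSwinnertonDyer.BirchSwinnertonDyer.Theorems.EisensteinPrimesAcTwistDeformationSurAtVbarFin
import Summits.BirchSwinnertonDyer.BirchSwinnertonDyer.Theorems.EisensteinPrimesAcTwistDeformationSurAtVbarOfForallDatum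
import Summits.BirchSwinnertonDyer.BirchSwinnertonDyer.Theorems.EisensteinPrimesIndexInputsUnramified
import Summits.BirchSwinnertonDyer.BirchSwinnertonDyer.Theorems.EisensteinPrimesResidualIndexAssembly
import HarnessLib

/-!
# Route `EisensteinPrimes`, crux 2 `GoodLatticeBDPValue` (stmt-BirchSwinnertonDyer-19032), line `halves` v20/v20.1
# (`Cruxes/GoodLatticeBDPValue/Lines/halves.lean`; `stub_indexInputs` byte-identical in a012386a… and 5ba462b7…):
# THE ∃-ASSEMBLY SHELL of `stub_indexInputs`, modulo the `H²` bookkeeping conjunct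

Cell `bsd-eis`, width seat `bsd-line-x1-p1-w7` (g0; `--supports -19032`, closes nothing). The registered stub
`stub_indexInputs` asks, on the binders of KY Thm. 1.4.1 and the cotorsion facts the composition holds, for ONE existential
package `∃ c τ Φ j₁ j₃ hj₁ hj₃, …` of 30 conjuncts ((R), Kummer, (U), SUR, COT, global/local `H⁰`, `H²`). All but the last
have by-name producers in the tree, stated universally over the line data; this file ASSEMBLES them:
`indexInputs_of_H2` has the stub's binders and cotorsion antecedents VERBATIM, the five Greenberg facts
`prop263_sur_of_crk`, `prop41_…`, `prop42_…`, `sec5A_…`, `prop32_…` (antecedents of the stub), and ONE hypothesis family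
`hH2` = the `H²` bookkeeping identity for every line datum `(Φ, j₁, j₃, hj₁, hj₃)` with `#Φ.Sub = #Φ.Quot = p`, injectivity
and socle ranges (width seat w4 gen 5's `IndexInputsH2`, from `cd_p(G_{K,Σ}) ≤ 2` [PUB] + weak Leopoldt), and concludes the
∃-package VERBATIM — so that the registered stub closes by
`intro …; exact IndexInputsShell.indexInputs_of_H2 … (fun Φ j₁ j₃ hj₁ hj₃ … ↦ …)` once `H²` lands (with its `cd_p ≤ 2`
antecedent added to the stub, w5's OBJECTION #2). Inside (all by name): the line `Φ, j₁, j₃`, the character Kummer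
conjuncts and the cardinalities from LEAD g3's `ResidualPairStableLine.exists_stableLine_of_isResidualPairOver` (p635113); the
exponent `c` (`κ(D_v̄) = p^c ℤ_p`), `τ := (γ ^ ·)` and the (R) conjuncts from w5's `IndexInputsReps` (p649187); the curve
Kummer conjuncts (as in w6's `IndexInputsH0`, p649330: `E_K[p] = E_K[p^∞][p]`, `E_K[p^∞]` divisible); (U) ×4 from w6's
`IndexInputsUnramified` (p650153); SUR ×3 from w3 gen 3's `…SurAtVbarFin` / `…SurAtVbarOfForallDatum` (p647873, p650032 —
consuming the stub's OWN `Sf`-imprimitive cotorsion clauses); COT ×6 from w5's `IndexInputsCot` (p648569); the twelve `H⁰`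
conjuncts from this seat's `ResidualIndexHZero.hZero_package` (p649681). The kernel check of this file is at the same time the
FIT PROBE of those producers against the registered types (a test restating the stub's signature verbatim and closing it by
`exact indexInputs_of_H2 … sorry` (only `hH2` sorried) elaborates; kept out of the tree).

HONEST FRAMING: helper theorems only (0 defs, 0 named facts, 0 sorry); the stub is NOT closed here (`H²` is a hypothesis); no
summit statement / BSD / IMC2 / KY Thm. 1.4.1 (iii) is proved; 0 cells move. References: [KellerYin2024] Thm. 1.4.1 and §1.4
(arXiv:2402.12781v2 TeX L1087–1330); the road memo `Lines/halves-imprimLambda-index-road.md`.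
-/

set_option autoImplicit false
-- the route's Theorems namespace repeats the summit name by design (D-0017 nested layout)
set_option linter.dupNamespace false

noncomputable section

open scoped Classical

namespace Summit.BirchSwinnertonDyer.BirchSwinnertonDyer.Theorems.IndexInputsShell

open PowerSeries WeierstrassCurve NumberField IsDedekindDomain Field
  Literature.NumberTheory.GaloisRepresentations Literature.NumberTheory.EllipticCurves.GreenbergVatsal2000
  Literature.NumberTheory.EllipticCurves Literature.NumberTheory.EllipticCurves.Rank1Residual
  Literature.NumberTheory.EllipticCurves.Castella2018 Literature.NumberTheory.EllipticCurves.GreenbergSelmer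
  Literature.NumberTheory.QuadraticFields Literature.NumberTheory.EllipticCurves.KellerYin2024
  Literature.NumberTheory.EllipticCurves.IwasawaAlgebra Literature.NumberTheory.IwasawaTheory
  Literature.NumberTheory.IwasawaTheory.Greenberg2016 Literature.NumberTheory.IwasawaTheory.Greenberg2006
  Literature.NumberTheory.EllipticCurves.FineSelmerCoefficientMap
  Summit.BirchSwinnertonDyer.Rank1Residual.X2.ResidualDevissageModules
  Summit.BirchSwinnertonDyer.BirchSwinnertonDyer.Theorems

/-- **SUR ×3 at `τ = (γ ^ ·)`** (the three SUR conjuncts of `stub_indexInputs`, bundled): w3 gen 3's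
`AcTwistDeformation.{char,curve}_forall_fin_exists_unramifiedOutside_resOfLe_conjH1_pow_eq` (Greenberg 2016 Prop. 2.6.3 by
name, from the stub's own `Sf`-imprimitive cotorsion clauses `hSsub`/`hSquot`, p650032/p647873), at any exact exponent
`c` (`κ(D_v̄) = p^c ℤ_p`). [cite: Greenberg2016Selmer, Prop. 2.6.3] [cite: KellerYin2024, Prop. 1.3.2, Rem. 1.4.2 (arXiv:2402.12781v2)] -/
theorem sur_package (h263 : prop263_sur_of_crk) (h41 : prop41_globalEulerPoincareCorank)
    (h42 : prop42_localEulerPoincareCorank) (h5A : sec5A_localH2_subsingleton_of_LOC1)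
    (h32 : prop32_cohomology_isCofinitelyGenerated)
    (W : WeierstrassCurve ℚ) [W.IsElliptic] [W.IsGloballyMinimal] (p : ℕ) [Fact p.Prime]
    (hp : 2 < p)
    (K : Type) [Field K] [NumberField K] (hK : IsImaginaryQuadratic K)
    (hH : SatisfiesHeegnerHypothesis (W.conductorNorm ℤ) K)
    (ι : K →+* ℚ_[p]) (v vbar : HeightOneSpectrum (𝓞 K))
    (hv : ∀ x : 𝓞 K, x ∈ v.asIdeal ↔ ‖ι (x : K)‖ < 1)
    (hvbar : ((p : ℕ) : 𝓞 K) ∈ vbar.asIdeal) (hne : vbar ≠ v)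
    (κ : ZpExtension K p) (hκ : κ.IsAnticyclotomic)
    (γ : absoluteGaloisGroup K) [Fact (κ.IsTopGenerator γ)]
    (θsub θquot : FramedGaloisRep K (padicCoeffIntegers (∅ : Set (PadicAlgCl p))) 1)
    (hpair : IsResidualPairOver (W.baseChange K) p θsub θquot)
    (Sf : Finset (HeightOneSpectrum (𝓞 K)))
    (hSf : ∀ w : HeightOneSpectrum (𝓞 K), w ∈ Sf ↔ ((W.conductorNorm ℤ : ℤ) : 𝓞 K) ∈ w.asIdeal)
    (hSsub : ∀ D : DatumDualData κ γ (charModule ∅ θsub)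
        (AcSelmer.bdpData (charModule ∅ θsub) p vbar) (↑Sf : Set (HeightOneSpectrum (𝓞 K))),
      Module.Finite (IwasawaAlgebra p) D.X ∧ Module.IsTorsion (IwasawaAlgebra p) D.X ∧ muInvariant p D.X = 0)
    (hSquot : ∀ D : DatumDualData κ γ (charModule ∅ θquot)
        (AcSelmer.bdpData (charModule ∅ θquot) p vbar) (↑Sf : Set (HeightOneSpectrum (𝓞 K))),
      Module.Finite (IwasawaAlgebra p) D.X ∧ Module.IsTorsion (IwasawaAlgebra p) D.X ∧ muInvariant p D.X = 0)
    (c : ℕ) (hc : ∃ δ ∈ decomp (K := K) vbar, (κ δ).toAdd = (p : ℤ_[p]) ^ c)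
    (hcd : ∀ δ ∈ decomp (K := K) vbar, (p : ℤ_[p]) ^ c ∣ (κ δ).toAdd) :
        (∀ y : Fin (p ^ c) → subgroupH1 (κ.kerSubgroup ⊓ decomp vbar) (charModule ∅ θsub), ∃ u ∈ unramifiedOutside κ.kerSubgroup (charModule ∅ θsub) p (↑Sf : Set (HeightOneSpectrum (𝓞 K))),
          ∀ i : Fin (p ^ c), resOfLe (charModule ∅ θsub) (inf_le_left : κ.kerSubgroup ⊓ decomp vbar ≤ κ.kerSubgroup) (conjH1 κ.kerSubgroup (charModule ∅ θsub) ((fun i : ℕ ↦ γ ^ i) i) u) = y i) ∧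
        (∀ y : Fin (p ^ c) → subgroupH1 (κ.kerSubgroup ⊓ decomp vbar) ↥((W.baseChange K).geomPrimaryTorsion p), ∃ u ∈ unramifiedOutside κ.kerSubgroup ↥((W.baseChange K).geomPrimaryTorsion p) p (↑Sf : Set (HeightOneSpectrum (𝓞 K))),
          ∀ i : Fin (p ^ c), resOfLe ↥((W.baseChange K).geomPrimaryTorsion p) (inf_le_left : κ.kerSubgroup ⊓ decomp vbar ≤ κ.kerSubgroup) (conjH1 κ.kerSubgroup ↥((W.baseChange K).geomPrimaryTorsion p) ((fun i : ℕ ↦ γ ^ i) i) u) = y i) ∧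
        (∀ y : Fin (p ^ c) → subgroupH1 (κ.kerSubgroup ⊓ decomp vbar) (charModule ∅ θquot), ∃ u ∈ unramifiedOutside κ.kerSubgroup (charModule ∅ θquot) p (↑Sf : Set (HeightOneSpectrum (𝓞 K))),
          ∀ i : Fin (p ^ c), resOfLe (charModule ∅ θquot) (inf_le_left : κ.kerSubgroup ⊓ decomp vbar ≤ κ.kerSubgroup) (conjH1 κ.kerSubgroup (charModule ∅ θquot) ((fun i : ℕ ↦ γ ^ i) i) u) = y i) :=
  ⟨AcTwistDeformation.char_forall_fin_exists_unramifiedOutside_resOfLe_conjH1_pow_eq_of_forall_datum h263 h41 h42 h5A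
      h32 W hp hK hH hv hvbar hne κ hκ γ hpair Sf hSf θsub (Or.inl rfl) hSsub c hc hcd,
    AcTwistDeformation.curve_forall_fin_exists_unramifiedOutside_resOfLe_conjH1_pow_eq h263 h41 h42 h5A h32
      W hp hK hH hv hvbar hne κ hκ γ hpair Sf hSf hSsub hSquot c hc hcd,
    AcTwistDeformation.char_forall_fin_exists_unramifiedOutside_resOfLe_conjH1_pow_eq_of_forall_datum h263 h41 h42 h5A
      h32 W hp hK hH hv hvbar hne κ hκ γ hpair Sf hSf θquot (Or.inr rfl) hSquot c hc hcd⟩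

/-- **COT ×6 and the twelve `H⁰` conjuncts, bundled** (in the stub's order): w5's `IndexInputsCot` (from the cotorsion
antecedents of the stub) and this seat's `ResidualIndexHZero.hZero_package` (its `hfinED` component dropped), for any line datum
`Φ` with `#Φ.Sub = #Φ.Quot = p` and an equivariant injective `j₃ : Φ.Quot →+ (F/𝒪)(θquot)`.
[cite: KellerYin2024, Thm. 1.4.1 (i)–(ii) and §1.4 (arXiv:2402.12781v2 TeX L1087–1098, L1178–1330)] -/
theorem cot_hZero_package
    (W : WeierstrassCurve ℚ) [W.IsElliptic] [W.IsGloballyMinimal] (p : ℕ) [Fact p.Prime]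
    (hp : 2 < p) (hanom : Anom W p)
    (hlat : ∀ Φ : AddSubgroup (geomTorsion W (p : ℤ)), IsRationalLine W p Φ → ¬ LineUnramifiedAt W p Φ)
    (K : Type) [Field K] [NumberField K] (hK : IsImaginaryQuadratic K)
    (htor : ∀ Q : (W.baseChange K).toAffine.Point, p • Q = 0 → Q = 0)
    (ι : K →+* ℚ_[p]) (v vbar : HeightOneSpectrum (𝓞 K))
    (hv : ∀ x : 𝓞 K, x ∈ v.asIdeal ↔ ‖ι (x : K)‖ < 1)
    (hvbar : ((p : ℕ) : 𝓞 K) ∈ vbar.asIdeal) (hne : vbar ≠ v)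
    (κ : ZpExtension K p) (hκ : κ.IsAnticyclotomic)
    (γ : absoluteGaloisGroup K) [Fact (κ.IsTopGenerator γ)]
    (θsub θquot : FramedGaloisRep K (padicCoeffIntegers (∅ : Set (PadicAlgCl p))) 1)
    (hpair : IsResidualPairOver (W.baseChange K) p θsub θquot)
    (Sf : Finset (HeightOneSpectrum (𝓞 K)))
    (hSf : ∀ w : HeightOneSpectrum (𝓞 K), w ∈ Sf ↔ ((W.conductorNorm ℤ : ℤ) : 𝓞 K) ∈ w.asIdeal)
    (hfgS : Module.Finite (IwasawaAlgebra p) (AcSelmer.XAc (W.baseChange K) p κ vbar (↑Sf : Set (HeightOneSpectrum (𝓞 K))) γ))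
    (htorS : Module.IsTorsion (IwasawaAlgebra p) (AcSelmer.XAc (W.baseChange K) p κ vbar (↑Sf : Set (HeightOneSpectrum (𝓞 K))) γ))
    (hμS : muInvariant p (AcSelmer.XAc (W.baseChange K) p κ vbar (↑Sf : Set (HeightOneSpectrum (𝓞 K))) γ) = 0)
    (hSsub : ∀ D : DatumDualData κ γ (charModule ∅ θsub)
        (AcSelmer.bdpData (charModule ∅ θsub) p vbar) (↑Sf : Set (HeightOneSpectrum (𝓞 K))),
      Module.Finite (IwasawaAlgebra p) D.X ∧ Module.IsTorsion (IwasawaAlgebra p) D.X ∧ muInvariant p D.X = 0)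
    (hSquot : ∀ D : DatumDualData κ γ (charModule ∅ θquot)
        (AcSelmer.bdpData (charModule ∅ θquot) p vbar) (↑Sf : Set (HeightOneSpectrum (𝓞 K))),
      Module.Finite (IwasawaAlgebra p) D.X ∧ Module.IsTorsion (IwasawaAlgebra p) D.X ∧ muInvariant p D.X = 0)
    (Φ : StableSubgroup (absoluteGaloisGroup K) ↥((W.baseChange K).geomTorsion (p : ℤ)))
    (hSub : Nat.card Φ.Sub = p) (hQuot : Nat.card Φ.Quot = p) (j₃ : Φ.Quot →+ charModule ∅ θquot)
    (hj₃ : ∀ (g : absoluteGaloisGroup K) (a : Φ.Quot), j₃ (g • a) = g • j₃ a) (hj₃inj : Function.Injective j₃) :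
        (∀ s : (datumStrictSelmer κ.kerSubgroup (charModule ∅ θsub) p (AcSelmer.bdpData (charModule ∅ θsub) p vbar) (↑Sf : Set (HeightOneSpectrum (𝓞 K)))), ∃ n : ℕ, p ^ n • s = 0) ∧
        (∀ s : (datumStrictSelmer κ.kerSubgroup ↥((W.baseChange K).geomPrimaryTorsion p) p (AcSelmer.bdpData ↥((W.baseChange K).geomPrimaryTorsion p) p vbar) (↑Sf : Set (HeightOneSpectrum (𝓞 K)))), ∃ n : ℕ, p ^ n • s = 0) ∧
        (∀ s : (datumStrictSelmer κ.kerSubgroup (charModule ∅ θquot) p (AcSelmer.bdpData (charModule ∅ θquot) p vbar) (↑Sf : Set (HeightOneSpectrum (𝓞 K)))), ∃ n : ℕ, p ^ n • s = 0) ∧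
        Finite (AddSubgroup.torsionBy (datumStrictSelmer κ.kerSubgroup (charModule ∅ θsub) p (AcSelmer.bdpData (charModule ∅ θsub) p vbar) (↑Sf : Set (HeightOneSpectrum (𝓞 K)))) (p : ℤ)) ∧
        Finite (AddSubgroup.torsionBy (datumStrictSelmer κ.kerSubgroup ↥((W.baseChange K).geomPrimaryTorsion p) p (AcSelmer.bdpData ↥((W.baseChange K).geomPrimaryTorsion p) p vbar) (↑Sf : Set (HeightOneSpectrum (𝓞 K)))) (p : ℤ)) ∧
        Finite (AddSubgroup.torsionBy (datumStrictSelmer κ.kerSubgroup (charModule ∅ θquot) p (AcSelmer.bdpData (charModule ∅ θquot) p vbar) (↑Sf : Set (HeightOneSpectrum (𝓞 K)))) (p : ℤ)) ∧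
        (∀ x : (charModule ∅ θsub), (∀ g : ↥κ.kerSubgroup, g • x = x) → ∃ x' : (charModule ∅ θsub), (∀ g : ↥κ.kerSubgroup, g • x' = x') ∧ p • x' = x) ∧
        (∀ x : ↥((W.baseChange K).geomPrimaryTorsion p), (∀ g : ↥κ.kerSubgroup, g • x = x) → ∃ x' : ↥((W.baseChange K).geomPrimaryTorsion p), (∀ g : ↥κ.kerSubgroup, g • x' = x') ∧ p • x' = x) ∧
        (∀ x : (charModule ∅ θquot), (∀ g : ↥κ.kerSubgroup, g • x = x) → ∃ x' : (charModule ∅ θquot), (∀ g : ↥κ.kerSubgroup, g • x' = x') ∧ p • x' = x) ∧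
        (∀ n : ↥((W.baseChange K).geomTorsion (p : ℤ)), (∀ g : ↥κ.kerSubgroup, g • n = n) → n = 0) ∧
        Finite {n : Φ.Quot // ∀ g : ↥κ.kerSubgroup, g • n = n} ∧
        Nat.card {n : Φ.Quot // ∀ g : ↥κ.kerSubgroup, g • n = n} = p ^ (if ∀ σ : absoluteGaloisGroup K, θquot σ = 1 then 1 else 0) ∧
        (∀ n : Φ.Sub, (∀ g : ↥(κ.kerSubgroup ⊓ decomp vbar), g • n = n) → n = 0) ∧
        (∀ (g : ↥(κ.kerSubgroup ⊓ decomp vbar)) (n : Φ.Quot), g • n = n) ∧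
        Finite Φ.Quot ∧ Nat.card Φ.Quot = p ∧
        (∀ x : (charModule ∅ θsub), (∀ g : ↥(κ.kerSubgroup ⊓ decomp vbar), g • x = x) → ∃ x' : (charModule ∅ θsub), (∀ g : ↥(κ.kerSubgroup ⊓ decomp vbar), g • x' = x') ∧ p • x' = x) ∧
        (∀ x : (charModule ∅ θquot), (∀ g : ↥(κ.kerSubgroup ⊓ decomp vbar), g • x = x) → ∃ x' : (charModule ∅ θquot), (∀ g : ↥(κ.kerSubgroup ⊓ decomp vbar), g • x' = x') ∧ p • x' = x) := by
  obtain ⟨hprim₁, hfin₁⟩ := IndexInputsCot.isPrimary_and_finite_torsionBy_datumStrictSelmer_charModule_of_forall p vbar κ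
    γ θsub (↑Sf : Set (HeightOneSpectrum (𝓞 K))) hSsub
  obtain ⟨hprim₃, hfin₃⟩ := IndexInputsCot.isPrimary_and_finite_torsionBy_datumStrictSelmer_charModule_of_forall p vbar κ
    γ θquot (↑Sf : Set (HeightOneSpectrum (𝓞 K))) hSquot
  haveI := hfgS
  obtain ⟨hprim₂, hfin₂⟩ := IndexInputsCot.isPrimary_and_finite_torsionBy_datumStrictSelmer_curve W p K vbar κ Sf hK hvbar
    γ hSf htorS hμS
  obtain ⟨hinv₁, hinv₂, hinv₃, hN₂, hfinq, hε, hN₁D, htrivD, hfinQ, hN₃, -, hinvD₁, hinvD₃⟩ :=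
    ResidualIndexHZero.hZero_package W p hp hanom hlat K hK htor ι v vbar hv hvbar hne κ hκ θsub θquot hpair Φ hSub hQuot
      j₃ hj₃ hj₃inj
  exact ⟨hprim₁, hprim₂, hprim₃, hfin₁, hfin₂, hfin₃, hinv₁, hinv₂, hinv₃, hN₂, hfinq, hε, hN₁D, htrivD, hfinQ, hN₃, hinvD₁,
    hinvD₃⟩

/-- **The ∃-assembly shell of `stub_indexInputs` (halves v20/v20.1, `stub_indexInputs` byte-identical in both), modulo `H²`.**
On the stub's binders and cotorsion antecedents (verbatim) and the five Greenberg facts by name, and GIVEN the `H²` bookkeeping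
identity for every line datum `(Φ, j₁, j₃)` with `#Φ.Sub = #Φ.Quot = p` and injective socle embeddings (the `hH2` family —
width seat w4 gen 5's `IndexInputsH2`, from `cd_p ≤ 2`): the existential package of `stub_indexInputs`, witnessed by `c` with
`κ(D_v̄) = p^c ℤ_p`, `τ = (γ ^ ·)`, and the residual line of `IsResidualPairOver`; every other conjunct from its landed
by-name producer. [cite: KellerYin2024, Thm. 1.4.1 and §1.4 (arXiv:2402.12781v2 TeX L1087–1330)]
[cite: GreenbergLNM1716, §1 p. 62] -/
theorem indexInputs_of_H2 (h263 : prop263_sur_of_crk) (h41 : prop41_globalEulerPoincareCorank)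
    (h42 : prop42_localEulerPoincareCorank) (h5A : sec5A_localH2_subsingleton_of_LOC1)
    (h32 : prop32_cohomology_isCofinitelyGenerated)
    (W : WeierstrassCurve ℚ) [W.IsElliptic] [W.IsGloballyMinimal] (p : ℕ) [Fact p.Prime]
    (hp : 2 < p) (hanom : Anom W p)
    (hlat : ∀ Φ : AddSubgroup (geomTorsion W (p : ℤ)), IsRationalLine W p Φ → ¬ LineUnramifiedAt W p Φ)
    (K : Type) [Field K] [NumberField K] (hK : IsImaginaryQuadratic K)
    (hH : SatisfiesHeegnerHypothesis (W.conductorNorm ℤ) K)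
    (htor : ∀ Q : (W.baseChange K).toAffine.Point, p • Q = 0 → Q = 0)
    (ι : K →+* ℚ_[p]) (v vbar : HeightOneSpectrum (𝓞 K))
    (hv : ∀ x : 𝓞 K, x ∈ v.asIdeal ↔ ‖ι (x : K)‖ < 1)
    (hvbar : ((p : ℕ) : 𝓞 K) ∈ vbar.asIdeal) (hne : vbar ≠ v)
    (κ : ZpExtension K p) (hκ : κ.IsAnticyclotomic)
    (γ : absoluteGaloisGroup K) [Fact (κ.IsTopGenerator γ)]
    (θsub θquot : FramedGaloisRep K (padicCoeffIntegers (∅ : Set (PadicAlgCl p))) 1)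
    (hpair : IsResidualPairOver (W.baseChange K) p θsub θquot)
    (Sf : Finset (HeightOneSpectrum (𝓞 K)))
    (hSf : ∀ w : HeightOneSpectrum (𝓞 K), w ∈ Sf ↔ ((W.conductorNorm ℤ : ℤ) : 𝓞 K) ∈ w.asIdeal)
    (hfgS : Module.Finite (IwasawaAlgebra p) (AcSelmer.XAc (W.baseChange K) p κ vbar (↑Sf : Set (HeightOneSpectrum (𝓞 K))) γ))
    (htorS : Module.IsTorsion (IwasawaAlgebra p) (AcSelmer.XAc (W.baseChange K) p κ vbar (↑Sf : Set (HeightOneSpectrum (𝓞 K))) γ))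
    (hμS : muInvariant p (AcSelmer.XAc (W.baseChange K) p κ vbar (↑Sf : Set (HeightOneSpectrum (𝓞 K))) γ) = 0)
    (hSsub : ∀ D : DatumDualData κ γ (charModule ∅ θsub)
        (AcSelmer.bdpData (charModule ∅ θsub) p vbar) (↑Sf : Set (HeightOneSpectrum (𝓞 K))),
      Module.Finite (IwasawaAlgebra p) D.X ∧ Module.IsTorsion (IwasawaAlgebra p) D.X ∧ muInvariant p D.X = 0)
    (hSquot : ∀ D : DatumDualData κ γ (charModule ∅ θquot)
        (AcSelmer.bdpData (charModule ∅ θquot) p vbar) (↑Sf : Set (HeightOneSpectrum (𝓞 K))),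
      Module.Finite (IwasawaAlgebra p) D.X ∧ Module.IsTorsion (IwasawaAlgebra p) D.X ∧ muInvariant p D.X = 0)
    (hH2 : ∀ (Φ : StableSubgroup (absoluteGaloisGroup K) ↥((W.baseChange K).geomTorsion (p : ℤ)))
        (j₁ : Φ.Sub →+ charModule ∅ θsub) (j₃ : Φ.Quot →+ charModule ∅ θquot)
        (hj₁ : ∀ (g : absoluteGaloisGroup K) (a : Φ.Sub), j₁ (g • a) = g • j₁ a)
        (hj₃ : ∀ (g : absoluteGaloisGroup K) (a : Φ.Quot), j₃ (g • a) = g • j₃ a),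
        Nat.card Φ.Sub = p → Nat.card Φ.Quot = p → Function.Injective j₁ → Function.Injective j₃ →
        (∀ x : charModule ∅ θsub, x ∈ j₁.range ↔ p • x = 0) → (∀ x : charModule ∅ θquot, x ∈ j₃.range ↔ p • x = 0) →
        Nat.card (↥(unramifiedOutside κ.kerSubgroup Φ.Quot p (↑Sf : Set (HeightOneSpectrum (𝓞 K)))) ⧸
            ((unramifiedOutside κ.kerSubgroup ↥((W.baseChange K).geomTorsion (p : ℤ)) p (↑Sf : Set (HeightOneSpectrum (𝓞 K)))).map (resH1Hom (ContinuousMonoidHom.id ↥κ.kerSubgroup) Φ.proj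
              (fun g b ↦ Φ.proj_smul (g : absoluteGaloisGroup K) b))).addSubgroupOf
                (unramifiedOutside κ.kerSubgroup Φ.Quot p (↑Sf : Set (HeightOneSpectrum (𝓞 K))))) *
            Nat.card (ModN (unramifiedOutside κ.kerSubgroup ↥((W.baseChange K).geomPrimaryTorsion p) p (↑Sf : Set (HeightOneSpectrum (𝓞 K)))) p) =
          Nat.card (ModN (unramifiedOutside κ.kerSubgroup (charModule ∅ θsub) p (↑Sf : Set (HeightOneSpectrum (𝓞 K)))) p) * Nat.card (ModN (unramifiedOutside κ.kerSubgroup (charModule ∅ θquot) p (↑Sf : Set (HeightOneSpectrum (𝓞 K)))) p)) :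
      ∃ (c : ℕ) (τ : ℕ → absoluteGaloisGroup K)
        (Φ : StableSubgroup (absoluteGaloisGroup K) ↥((W.baseChange K).geomTorsion (p : ℤ)))
        (j₁ : Φ.Sub →+ charModule ∅ θsub) (j₃ : Φ.Quot →+ charModule ∅ θquot)
        (hj₁ : ∀ (g : absoluteGaloisGroup K) (a : Φ.Sub), j₁ (g • a) = g • j₁ a)
        (hj₃ : ∀ (g : absoluteGaloisGroup K) (a : Φ.Quot), j₃ (g • a) = g • j₃ a),
        -- (R) representatives
        (∀ i : ℕ, κ (τ i) = Multiplicative.ofAdd ((i : ℕ) : ℤ_[p])) ∧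
        (∀ i j : ℕ, i < p ^ c → j < p ^ c → i ≠ j → ∀ δ ∈ decomp vbar,
          Multiplicative.ofAdd ((j : ℕ) : ℤ_[p]) ≠ Multiplicative.ofAdd ((i : ℕ) : ℤ_[p]) * κ δ) ∧
        (∀ x : subgroupH1 κ.kerSubgroup (charModule ∅ θsub),
          (∀ i, i < p ^ c → resOfLe (charModule ∅ θsub) (inf_le_left : κ.kerSubgroup ⊓ decomp vbar ≤ κ.kerSubgroup) (conjH1 κ.kerSubgroup (charModule ∅ θsub) (τ i) x) = 0) →
            ∀ σ : absoluteGaloisGroup K, resOfLe (charModule ∅ θsub) (inf_le_left : κ.kerSubgroup ⊓ decomp vbar ≤ κ.kerSubgroup) (conjH1 κ.kerSubgroup (charModule ∅ θsub) σ x) = 0) ∧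
        (∀ x : subgroupH1 κ.kerSubgroup ↥((W.baseChange K).geomPrimaryTorsion p),
          (∀ i, i < p ^ c → resOfLe ↥((W.baseChange K).geomPrimaryTorsion p) (inf_le_left : κ.kerSubgroup ⊓ decomp vbar ≤ κ.kerSubgroup) (conjH1 κ.kerSubgroup ↥((W.baseChange K).geomPrimaryTorsion p) (τ i) x) = 0) →
            ∀ σ : absoluteGaloisGroup K, resOfLe ↥((W.baseChange K).geomPrimaryTorsion p) (inf_le_left : κ.kerSubgroup ⊓ decomp vbar ≤ κ.kerSubgroup) (conjH1 κ.kerSubgroup ↥((W.baseChange K).geomPrimaryTorsion p) σ x) = 0) ∧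
        (∀ x : subgroupH1 κ.kerSubgroup (charModule ∅ θquot),
          (∀ i, i < p ^ c → resOfLe (charModule ∅ θquot) (inf_le_left : κ.kerSubgroup ⊓ decomp vbar ≤ κ.kerSubgroup) (conjH1 κ.kerSubgroup (charModule ∅ θquot) (τ i) x) = 0) →
            ∀ σ : absoluteGaloisGroup K, resOfLe (charModule ∅ θquot) (inf_le_left : κ.kerSubgroup ⊓ decomp vbar ≤ κ.kerSubgroup) (conjH1 κ.kerSubgroup (charModule ∅ θquot) σ x) = 0) ∧
        -- the Kummer embeddings
        Function.Injective j₁ ∧ Function.Injective j₃ ∧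
        (∀ x : charModule ∅ θsub, x ∈ j₁.range ↔ p • x = 0) ∧ (∀ x : charModule ∅ θquot, x ∈ j₃.range ↔ p • x = 0) ∧
        (∀ x : ↥((W.baseChange K).geomPrimaryTorsion p), x ∈ (AddSubgroup.inclusion (geomTorsion_le_geomPrimaryTorsion (W.baseChange K) p)).range ↔ p • x = 0) ∧
        (∀ x : ↥((W.baseChange K).geomPrimaryTorsion p), ∃ x' : ↥((W.baseChange K).geomPrimaryTorsion p), p • x' = x) ∧
        -- (U)
        (∀ w : HeightOneSpectrum (𝓞 K), w ∉ (↑Sf : Set (HeightOneSpectrum (𝓞 K))) → ((p : ℕ) : 𝓞 K) ∉ w.asIdeal →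
          Function.Injective (resH1Hom (ContinuousMonoidHom.id (inertiaIn κ.kerSubgroup w)) Φ.incl
            (fun g m ↦ Φ.incl_smul ((g : decomp (K := K) w) : absoluteGaloisGroup K) m))) ∧
        (∀ w : HeightOneSpectrum (𝓞 K), w ∉ (↑Sf : Set (HeightOneSpectrum (𝓞 K))) → ((p : ℕ) : 𝓞 K) ∉ w.asIdeal →
          Function.Injective (resH1Hom (ContinuousMonoidHom.id (inertiaIn κ.kerSubgroup w)) j₁
            (fun g m ↦ hj₁ ((g : decomp (K := K) w) : absoluteGaloisGroup K) m))) ∧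
        (∀ w : HeightOneSpectrum (𝓞 K), w ∉ (↑Sf : Set (HeightOneSpectrum (𝓞 K))) → ((p : ℕ) : 𝓞 K) ∉ w.asIdeal →
          Function.Injective (resH1Hom (ContinuousMonoidHom.id (inertiaIn κ.kerSubgroup w)) (AddSubgroup.inclusion (geomTorsion_le_geomPrimaryTorsion (W.baseChange K) p))
            (fun (g : inertiaIn κ.kerSubgroup w) (m : ↥((W.baseChange K).geomTorsion (p : ℤ))) ↦
              (rfl : (AddSubgroup.inclusion (geomTorsion_le_geomPrimaryTorsion (W.baseChange K) p)) (((g : decomp (K := K) w) : absoluteGaloisGroup K) • m) =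
                ((g : decomp (K := K) w) : absoluteGaloisGroup K) • (AddSubgroup.inclusion (geomTorsion_le_geomPrimaryTorsion (W.baseChange K) p)) m)))) ∧
        (∀ w : HeightOneSpectrum (𝓞 K), w ∉ (↑Sf : Set (HeightOneSpectrum (𝓞 K))) → ((p : ℕ) : 𝓞 K) ∉ w.asIdeal →
          Function.Injective (resH1Hom (ContinuousMonoidHom.id (inertiaIn κ.kerSubgroup w)) j₃
            (fun g m ↦ hj₃ ((g : decomp (K := K) w) : absoluteGaloisGroup K) m))) ∧
        -- SUR
        (∀ y : Fin (p ^ c) → subgroupH1 (κ.kerSubgroup ⊓ decomp vbar) (charModule ∅ θsub), ∃ u ∈ unramifiedOutside κ.kerSubgroup (charModule ∅ θsub) p (↑Sf : Set (HeightOneSpectrum (𝓞 K))),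
          ∀ i : Fin (p ^ c), resOfLe (charModule ∅ θsub) (inf_le_left : κ.kerSubgroup ⊓ decomp vbar ≤ κ.kerSubgroup) (conjH1 κ.kerSubgroup (charModule ∅ θsub) (τ i) u) = y i) ∧
        (∀ y : Fin (p ^ c) → subgroupH1 (κ.kerSubgroup ⊓ decomp vbar) ↥((W.baseChange K).geomPrimaryTorsion p), ∃ u ∈ unramifiedOutside κ.kerSubgroup ↥((W.baseChange K).geomPrimaryTorsion p) p (↑Sf : Set (HeightOneSpectrum (𝓞 K))),
          ∀ i : Fin (p ^ c), resOfLe ↥((W.baseChange K).geomPrimaryTorsion p) (inf_le_left : κ.kerSubgroup ⊓ decomp vbar ≤ κ.kerSubgroup) (conjH1 κ.kerSubgroup ↥((W.baseChange K).geomPrimaryTorsion p) (τ i) u) = y i) ∧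
        (∀ y : Fin (p ^ c) → subgroupH1 (κ.kerSubgroup ⊓ decomp vbar) (charModule ∅ θquot), ∃ u ∈ unramifiedOutside κ.kerSubgroup (charModule ∅ θquot) p (↑Sf : Set (HeightOneSpectrum (𝓞 K))),
          ∀ i : Fin (p ^ c), resOfLe (charModule ∅ θquot) (inf_le_left : κ.kerSubgroup ⊓ decomp vbar ≤ κ.kerSubgroup) (conjH1 κ.kerSubgroup (charModule ∅ θquot) (τ i) u) = y i) ∧
        -- COT
        (∀ s : (datumStrictSelmer κ.kerSubgroup (charModule ∅ θsub) p (AcSelmer.bdpData (charModule ∅ θsub) p vbar) (↑Sf : Set (HeightOneSpectrum (𝓞 K)))), ∃ n : ℕ, p ^ n • s = 0) ∧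
        (∀ s : (datumStrictSelmer κ.kerSubgroup ↥((W.baseChange K).geomPrimaryTorsion p) p (AcSelmer.bdpData ↥((W.baseChange K).geomPrimaryTorsion p) p vbar) (↑Sf : Set (HeightOneSpectrum (𝓞 K)))), ∃ n : ℕ, p ^ n • s = 0) ∧
        (∀ s : (datumStrictSelmer κ.kerSubgroup (charModule ∅ θquot) p (AcSelmer.bdpData (charModule ∅ θquot) p vbar) (↑Sf : Set (HeightOneSpectrum (𝓞 K)))), ∃ n : ℕ, p ^ n • s = 0) ∧
        Finite (AddSubgroup.torsionBy (datumStrictSelmer κ.kerSubgroup (charModule ∅ θsub) p (AcSelmer.bdpData (charModule ∅ θsub) p vbar) (↑Sf : Set (HeightOneSpectrum (𝓞 K)))) (p : ℤ)) ∧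
        Finite (AddSubgroup.torsionBy (datumStrictSelmer κ.kerSubgroup ↥((W.baseChange K).geomPrimaryTorsion p) p (AcSelmer.bdpData ↥((W.baseChange K).geomPrimaryTorsion p) p vbar) (↑Sf : Set (HeightOneSpectrum (𝓞 K)))) (p : ℤ)) ∧
        Finite (AddSubgroup.torsionBy (datumStrictSelmer κ.kerSubgroup (charModule ∅ θquot) p (AcSelmer.bdpData (charModule ∅ θquot) p vbar) (↑Sf : Set (HeightOneSpectrum (𝓞 K)))) (p : ℤ)) ∧
        -- global H⁰
        (∀ x : (charModule ∅ θsub), (∀ g : ↥κ.kerSubgroup, g • x = x) → ∃ x' : (charModule ∅ θsub), (∀ g : ↥κ.kerSubgroup, g • x' = x') ∧ p • x' = x) ∧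
        (∀ x : ↥((W.baseChange K).geomPrimaryTorsion p), (∀ g : ↥κ.kerSubgroup, g • x = x) → ∃ x' : ↥((W.baseChange K).geomPrimaryTorsion p), (∀ g : ↥κ.kerSubgroup, g • x' = x') ∧ p • x' = x) ∧
        (∀ x : (charModule ∅ θquot), (∀ g : ↥κ.kerSubgroup, g • x = x) → ∃ x' : (charModule ∅ θquot), (∀ g : ↥κ.kerSubgroup, g • x' = x') ∧ p • x' = x) ∧
        (∀ n : ↥((W.baseChange K).geomTorsion (p : ℤ)), (∀ g : ↥κ.kerSubgroup, g • n = n) → n = 0) ∧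
        Finite {n : Φ.Quot // ∀ g : ↥κ.kerSubgroup, g • n = n} ∧
        Nat.card {n : Φ.Quot // ∀ g : ↥κ.kerSubgroup, g • n = n} = p ^ (if ∀ σ : absoluteGaloisGroup K, θquot σ = 1 then 1 else 0) ∧
        -- local H⁰ at `H ⊓ D_v̄`
        (∀ n : Φ.Sub, (∀ g : ↥(κ.kerSubgroup ⊓ decomp vbar), g • n = n) → n = 0) ∧
        (∀ (g : ↥(κ.kerSubgroup ⊓ decomp vbar)) (n : Φ.Quot), g • n = n) ∧
        Finite Φ.Quot ∧ Nat.card Φ.Quot = p ∧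
        (∀ x : (charModule ∅ θsub), (∀ g : ↥(κ.kerSubgroup ⊓ decomp vbar), g • x = x) → ∃ x' : (charModule ∅ θsub), (∀ g : ↥(κ.kerSubgroup ⊓ decomp vbar), g • x' = x') ∧ p • x' = x) ∧
        (∀ x : (charModule ∅ θquot), (∀ g : ↥(κ.kerSubgroup ⊓ decomp vbar), g • x = x) → ∃ x' : (charModule ∅ θquot), (∀ g : ↥(κ.kerSubgroup ⊓ decomp vbar), g • x' = x') ∧ p • x' = x) ∧
        -- H² bookkeeping
        Nat.card (↥(unramifiedOutside κ.kerSubgroup Φ.Quot p (↑Sf : Set (HeightOneSpectrum (𝓞 K)))) ⧸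
            ((unramifiedOutside κ.kerSubgroup ↥((W.baseChange K).geomTorsion (p : ℤ)) p (↑Sf : Set (HeightOneSpectrum (𝓞 K)))).map (resH1Hom (ContinuousMonoidHom.id ↥κ.kerSubgroup) Φ.proj
              (fun g b ↦ Φ.proj_smul (g : absoluteGaloisGroup K) b))).addSubgroupOf
                (unramifiedOutside κ.kerSubgroup Φ.Quot p (↑Sf : Set (HeightOneSpectrum (𝓞 K))))) *
            Nat.card (ModN (unramifiedOutside κ.kerSubgroup ↥((W.baseChange K).geomPrimaryTorsion p) p (↑Sf : Set (HeightOneSpectrum (𝓞 K)))) p) =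
          Nat.card (ModN (unramifiedOutside κ.kerSubgroup (charModule ∅ θsub) p (↑Sf : Set (HeightOneSpectrum (𝓞 K)))) p) * Nat.card (ModN (unramifiedOutside κ.kerSubgroup (charModule ∅ θquot) p (↑Sf : Set (HeightOneSpectrum (𝓞 K)))) p) := by
  have hγ : κ.IsTopGenerator γ := Fact.out
  -- the residual line with its socle embeddings
  obtain ⟨Φ, hSub, hQuot, ⟨j₁, hj₁, hj₁inj, hr₁⟩, ⟨j₃, hj₃, hj₃inj, hr₃⟩⟩ :=
    ResidualPairStableLine.exists_stableLine_of_isResidualPairOver (W.baseChange K) hpair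
  -- the exponent `c` and the representatives `γ ^ i`
  obtain ⟨c, hc, hcd⟩ := IndexInputsReps.exists_pow_generates_decomp_of_isImaginaryQuadratic κ hK hvbar
  obtain ⟨hτ, hdist, hreps⟩ := IndexInputsReps.reps_package_of_pow_generates κ vbar hγ hc hcd
  -- SUR ×3, COT ×6, H⁰ ×12
  have hsur := sur_package h263 h41 h42 h5A h32 W p hp K hK hH ι v vbar hv hvbar hne κ hκ γ θsub θquot hpair Sf hSf hSsub
    hSquot c hc hcd
  obtain ⟨hsur₁, hsur₂, hsur₃⟩ := hsur
  -- (`have` first, then destructure: `obtain … := <application>` of this size exceeds the default heartbeats)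
  have hpack := cot_hZero_package W p hp hanom hlat K hK htor ι v vbar hv hvbar hne κ hκ γ θsub θquot hpair Sf hSf hfgS htorS
    hμS hSsub hSquot Φ hSub hQuot j₃ hj₃ hj₃inj
  obtain ⟨hprim₁, hprim₂, hprim₃, hfin₁, hfin₂, hfin₃, hinv₁, hinv₂, hinv₃, hN₂, hfinq, hε, hN₁D, htrivD, hfinQ, hN₃, hinvD₁,
      hinvD₃⟩ := hpack
  -- the curve-side Kummer conjuncts (`hr₂`, `hd₂`; cf. `IndexInputsH0`, p649330)
  have hr₂ : ∀ x : ↥((W.baseChange K).geomPrimaryTorsion p),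
      x ∈ (AddSubgroup.inclusion (geomTorsion_le_geomPrimaryTorsion (W.baseChange K) p)).range ↔ p • x = 0 := by
    intro x
    constructor
    · rintro ⟨y, rfl⟩
      apply Subtype.ext
      rw [AddSubgroupClass.coe_nsmul, AddSubgroup.coe_inclusion, ZeroMemClass.coe_zero, ← natCast_zsmul]
      exact (Submodule.mem_torsionBy_iff _ _).mp y.2
    · intro hx
      have hx' : (p : ℤ) • (x : geomPoints (W.baseChange K)) = 0 := by
        rw [natCast_zsmul, ← AddSubgroupClass.coe_nsmul, hx, ZeroMemClass.coe_zero]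
      exact ⟨⟨(x : geomPoints (W.baseChange K)), (Submodule.mem_torsionBy_iff _ _).mpr hx'⟩, Subtype.ext rfl⟩
  have hd₂ : ∀ x : ↥((W.baseChange K).geomPrimaryTorsion p), ∃ x' : ↥((W.baseChange K).geomPrimaryTorsion p),
      p • x' = x :=
    exists_nsmul_eq_geomPrimaryTorsion (W.baseChange K) p (W.baseChange K).zsmul_geomPoints_surjective_holds
  -- (U) ×4 (Néron–Ogg–Shafarevich transport; width seat w6's `IndexInputsUnramified`, p650153)
  have hθsub : ∀ σ : absoluteGaloisGroup K, θsub σ ^ (p - 1) = 1 := fun σ ↦ (hpair.pow_sub_one σ).1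
  have hθquot : ∀ σ : absoluteGaloisGroup K, θquot σ ^ (p - 1) = 1 := fun σ ↦ (hpair.pow_sub_one σ).2
  -- H² from the hypothesis
  have hH2' := hH2 Φ j₁ j₃ hj₁ hj₃ hSub hQuot hj₁inj hj₃inj hr₁ hr₃
  exact ⟨c, fun i : ℕ ↦ γ ^ i, Φ, j₁, j₃, hj₁, hj₃, hτ, hdist, hreps _, hreps _, hreps _, hj₁inj, hj₃inj, hr₁, hr₃, hr₂, hd₂,
    fun w hw hpw ↦ IndexInputsH0.injective_resH1Hom_inertiaIn_incl W κ.kerSubgroup Sf hSf Φ w hw hpw,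
    fun w _ _ ↦ IndexInputsH0.injective_resH1Hom_inertiaIn_of_charModule κ.kerSubgroup θsub hθsub j₁ hj₁ hj₁inj hr₁ w,
    fun w hw hpw ↦ IndexInputsH0.injective_resH1Hom_inertiaIn_inclusion W κ.kerSubgroup Sf hSf w hw hpw,
    fun w _ _ ↦ IndexInputsH0.injective_resH1Hom_inertiaIn_of_charModule κ.kerSubgroup θquot hθquot j₃ hj₃ hj₃inj hr₃ w,
    hsur₁, hsur₂, hsur₃, hprim₁, hprim₂, hprim₃, hfin₁, hfin₂, hfin₃,
    hinv₁, hinv₂, hinv₃, hN₂, hfinq, hε, hN₁D, htrivD, hfinQ, hN₃, hinvD₁, hinvD₃, hH2'⟩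

end Summit.BirchSwinnertonDyer.BirchSwinnertonDyer.Theorems.IndexInputsShell

end
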